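import Literature.NumberTheory.Sieve.SmoothParitySingular
import HarnessLib

/-!
# The parity-class singular series: the `2`-adic factor and the local factors at prime powers

Topic `Literature/NumberTheory/Sieve`; a PROVED tool file continuing `SmoothParitySingular`
([MontgomeryVaughanActa1975, §5–6], [Harper2016, §2.2]). Notation: `LF = classLocalFactor α`,
`T(k) = parityUnitTerm`, `G_α = localG`, `c_q(h)` the Ramanujan sum.

* `classLocalFactor_two_one_two_pow`: `LF(2,1,2^j; h) = c_{2^j}(h) (1 − 2^{−α})/φ(2^j)` (`j ≥ 1`), so the terms
  at `2^j`, `j ≥ 2`, VANISH when `σd₂` is odd (`c_{2^j}(odd) = μ(2^j) = 0`): `paritySingTerm_two_pow_eq_zero`,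
  `paritySingTerm_eq_zero_of_four_dvd`; the values `paritySingTerm 1 = (1 − 2^{−α})²`,
  `paritySingTerm 2 = −(1 − 2^{−α})²(2^{1−α} − 1)` (`d₁` even, `σd₂` odd);
* **(S3)** `parityLocalTwo_eq`: `parityLocalTwo = 2 (1 − 2^{−α})³` for `σ = ±1`, `d₁` even, `d₂` odd, and the
  **independence of the power of `2`**: `paritySingTerm (2^N t) d₂ k = paritySingTerm (2t) d₂ k` (`N ≥ 1`, every `k`),
  `paritySingSeries_two_pow_mul`;
* the modulus-one local factor as a REAL number `unitLocalFactor α k h = Λ_α(k; h) = Σ_{g ∣ k} c_{k/g}(h) g^{−α}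
  ∏_{p ∣ k/g}(1 − p^{−α})/φ(k/g)` (`classLocalFactor_one_eq_ofReal`), Kluyver at prime powers
  (`ramanujanDivisorSum_prime_pow_succ`), the recurrence
  `Λ(p^{j+1}; h) = p^{−α} Λ(p^j; h) + c_{p^{j+1}}(h)(1 − p^{−α})/φ(p^{j+1})` and its solution:
  `Λ(p^j; h) = 1` if `p^j ∣ h`, `Λ(p^{v+1+i}; h) = G_α(p^{i+1})` if `p^v ∥ h`; hence `0 ≤ Λ(p^j; h) ≤ 1`
  (`unitLocalFactor_prime_pow_mem_Icc`, with `localG_le_one`: `G_α(q) ≤ 1`).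

The pointwise majorant and summability follow in `SmoothParitySingularMajorant` / `SmoothParitySingularBounds`.

## References

* H. L. Montgomery, R. C. Vaughan, *The exceptional set in Goldbach's problem*, Acta Arith. 27 (1975), §5–6
  (singular series of a ternary problem with congruence conditions; local factors) [MontgomeryVaughanActa1975].
* A. J. Harper, Compositio Math. 152 (2016), §2.2, §5 (the smooth local factors `G_α`, `H_α`) [Harper2016].
* H. L. Montgomery, R. C. Vaughan, *Multiplicative Number Theory I* (2007), Thm 4.1 (Ramanujan sums), §1.3
  (Euler products) [MontgomeryVaughan2007].
-/

noncomputable section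

open Finset Real Complex
open scoped ArithmeticFunction.Moebius FourierTransform

namespace Literature.NumberTheory.Sieve

namespace SmoothArcs

/-! ### The `2`-adic factor -/

/-- `LF(2, 1, 2^j; h) = c_{2^j}(h) · (1 − 2^{−α})/φ(2^j)` for `j ≥ 1`: the class `t ≡ 1 (2)` consists of the units
mod `2^j`, all of weight `(1 − 2^{−α})/φ(2^j)`. [folklore] -/
theorem classLocalFactor_two_one_two_pow (α : ℝ) {j : ℕ} (hj : j ≠ 0) (h : ℤ) :
    classLocalFactor α 2 1 (2 ^ j) h =
      ramanujanSum (2 ^ j) h * ((((1 - (2 : ℝ) ^ (-α)) / ((2 ^ j).totient : ℝ)) : ℝ) : ℂ) := by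
  unfold classLocalFactor
  have hl : Nat.lcm (2 ^ j) 2 = 2 ^ j := Nat.lcm_eq_left (dvd_pow_self 2 hj)
  rw [hl]
  have hfilt : (Finset.range (2 ^ j)).filter (fun t => t ≡ 1 [MOD 2]) =
      (Finset.range (2 ^ j)).filter (fun t => t.Coprime (2 ^ j)) := by
    refine Finset.filter_congr fun t _ => ?_
    rw [Nat.coprime_pow_right_iff (Nat.pos_of_ne_zero hj), Nat.coprime_comm, Nat.prime_two.coprime_iff_not_dvd,
      Nat.two_dvd_ne_zero]
    exact Iff.rfl
  rw [hfilt, ramanujanSum, Finset.sum_mul]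
  refine Finset.sum_congr rfl fun t ht => ?_
  obtain ⟨-, htc⟩ := Finset.mem_filter.mp ht
  rw [Nat.Coprime.gcd_eq_one htc, Nat.div_one, Nat.primeFactors_prime_pow hj Nat.prime_two, Finset.prod_singleton,
    mul_comm (h : ℝ) t, Nat.cast_one, Real.one_rpow, one_mul]
  push_cast
  ring

/-- `c_{2^j}(h) = 0` for `j ≥ 2` and odd `h` (`= μ(2^j)`). [folklore] -/
theorem ramanujanSum_two_pow_eq_zero {j : ℕ} (hj : 2 ≤ j) {h : ℤ} (hh : Odd h) : ramanujanSum (2 ^ j) h = 0 := by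
  have hcop : (2 ^ j).Coprime h.natAbs :=
    Nat.Coprime.pow_left _ (Nat.prime_two.coprime_iff_not_dvd.mpr (Int.natAbs_odd.mpr hh).not_two_dvd_nat)
  rw [ramanujanSum_eq_moebius_of_coprime_natAbs hcop, ArithmeticFunction.moebius_apply_prime_pow Nat.prime_two
    (by omega), if_neg (by omega)]
  simp

/-- The terms at `2^j`, `j ≥ 2`, VANISH when `σ d₂` is odd: the factor `LF(2,1,2^j; σd₂a)` is a multiple of
`c_{2^j}(odd) = μ(2^j) = 0`. [folklore] -/
theorem paritySingTerm_two_pow_eq_zero (α : ℝ) {σ : ℤ} {d₂ : ℕ} (hσd : Odd (σ * d₂)) (d₁ : ℕ) {j : ℕ}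
    (hj : 2 ≤ j) : paritySingTerm α σ d₁ d₂ (2 ^ j) = 0 := by
  unfold paritySingTerm
  refine Finset.sum_eq_zero fun a ha => ?_
  obtain ⟨-, hac⟩ := Finset.mem_filter.mp ha
  have ha2 : Odd (a : ℤ) := by
    rw [Int.odd_coe_nat]
    exact Nat.Coprime.odd_of_left (Nat.Coprime.coprime_dvd_left (dvd_pow_self 2 (by omega)) hac)
  have hodd : Odd (σ * (d₂ * a : ℤ)) := by rw [← mul_assoc]; exact hσd.mul ha2
  rw [classLocalFactor_two_one_two_pow α (by omega) (σ * (d₂ * a)), ramanujanSum_two_pow_eq_zero hj hodd]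
  simp

/-- Consequently `paritySingTerm k = 0` whenever `4 ∣ k` (write `k = 2^i k'`, `k'` odd, `i ≥ 2`). [folklore] -/
theorem paritySingTerm_eq_zero_of_four_dvd (α : ℝ) {σ : ℤ} {d₂ : ℕ} (hσd : Odd (σ * d₂)) (d₁ : ℕ) {k : ℕ}
    (hk : 4 ∣ k) : paritySingTerm α σ d₁ d₂ k = 0 := by
  rcases eq_or_ne k 0 with rfl | hk0
  · simp [paritySingTerm]
  obtain ⟨i, k', hk', rfl⟩ := Nat.exists_eq_two_pow_mul_odd hk0
  have hcop : (2 ^ i).Coprime k' :=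
    Nat.Coprime.pow_left i (Nat.prime_two.coprime_iff_not_dvd.mpr hk'.not_two_dvd_nat)
  have hi : 2 ≤ i := by
    by_contra hi
    have h4 : (2 ^ 2).Coprime k' := Nat.Coprime.pow_left 2 (Nat.prime_two.coprime_iff_not_dvd.mpr hk'.not_two_dvd_nat)
    have h1 : 2 ^ 2 ∣ 2 ^ i := (h4.dvd_of_dvd_mul_right (by simpa using hk))
    have := Nat.pow_dvd_pow_iff_le_right (by norm_num : 1 < 2) |>.mp h1
    omega
  rw [paritySingTerm_mul_of_coprime α σ d₁ d₂ hcop hk', paritySingTerm_two_pow_eq_zero α hσd d₁ hi, zero_mul]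

/-- `LF(2, 1, 1; h) = 1 − 2^{−α}`. [folklore] -/
theorem classLocalFactor_two_one_one (α : ℝ) (h : ℤ) :
    classLocalFactor α 2 1 1 h = (((1 - (2 : ℝ) ^ (-α)) : ℝ) : ℂ) := by
  unfold classLocalFactor
  rw [show Nat.lcm 1 2 = 2 by norm_num, show (Finset.range 2).filter (fun t => t ≡ 1 [MOD 2]) = {1} by decide,
    Finset.sum_singleton, show Nat.gcd 1 2 = 1 by norm_num, Nat.div_one, Nat.prime_two.primeFactors,
    Finset.prod_singleton, Nat.totient_two]
  simp only [Nat.cast_one, Real.one_rpow, mul_one, div_one, one_mul, RamanujanSum.fourierChar_intCast h]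
  push_cast
  ring

/-- `paritySingTerm 1 = (1 − 2^{−α})²`. [folklore] -/
theorem paritySingTerm_one (α : ℝ) (σ : ℤ) (d₁ d₂ : ℕ) :
    paritySingTerm α σ d₁ d₂ 1 = (((1 - (2 : ℝ) ^ (-α)) ^ 2 : ℝ) : ℂ) := by
  unfold paritySingTerm
  rw [show (Finset.range 1).filter (Nat.Coprime 1) = {0} by decide, Finset.sum_singleton,
    classLocalFactor_two_one_one, classLocalFactor_two_one_one, classLocalFactor_one_one, map_one]
  push_cast
  ring

/-- `G_α(2) = 2^{1−α} − 1 = 2 · 2^{−α} − 1`. [folklore] -/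
theorem localG_two (α : ℝ) : localG α 2 = 2 * (2 : ℝ) ^ (-α) - 1 := by
  rw [localG_eq_prod α two_ne_zero, Nat.prime_two.primeFactors, Finset.prod_singleton]
  have h2 : (2 : ℝ) ^ (-α) * (2 : ℝ) ^ α = 1 := by
    rw [← Real.rpow_add (by norm_num : (0 : ℝ) < 2), neg_add_cancel, Real.rpow_zero]
  push_cast
  rw [show (2 : ℝ) - 1 = 1 by norm_num, div_one, mul_sub, h2]
  ring

/-- `paritySingTerm 2 = −(1 − 2^{−α})² (2·2^{−α} − 1)` for `d₁` even and `σ d₂` odd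
(`LF(2,1,2; even) = 1 − 2^{−α}`, `LF(2,1,2; odd) = −(1 − 2^{−α})`, `G_α(2) = 2^{1−α} − 1`). [folklore] -/
theorem paritySingTerm_two (α : ℝ) {σ : ℤ} {d₂ : ℕ} (hσd : Odd (σ * d₂)) {d₁ : ℕ} (hd₁ : Even d₁) :
    paritySingTerm α σ d₁ d₂ 2 = ((-((1 - (2 : ℝ) ^ (-α)) ^ 2 * (2 * (2 : ℝ) ^ (-α) - 1)) : ℝ) : ℂ) := by
  have hLF : ∀ h : ℤ, classLocalFactor α 2 1 2 h = ramanujanSum 2 h * (((1 - (2 : ℝ) ^ (-α)) : ℝ) : ℂ) := by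
    intro h
    have := classLocalFactor_two_one_two_pow α one_ne_zero h
    rwa [pow_one, Nat.totient_two, Nat.cast_one, div_one] at this
  have h1 : ramanujanSum 2 d₁ = 1 := by
    rw [ramanujanSum_prime Nat.prime_two, if_pos (Int.natCast_dvd_natCast.mpr hd₁.two_dvd)]
    norm_num
  have h2 : ramanujanSum 2 (σ * d₂) = -1 := by
    rw [ramanujanSum_prime Nat.prime_two, if_neg]
    rw [Nat.cast_ofNat, Int.two_dvd_ne_zero]
    exact Int.odd_iff.mp hσd
  have h3 : classLocalFactor α 1 0 2 (1 : ℕ) = ((2 * (2 : ℝ) ^ (-α) - 1 : ℝ) : ℂ) := by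
    rw [classLocalFactor_one_eq_localG α 0 two_ne_zero (Nat.coprime_one_left 2), localG_two]
  unfold paritySingTerm
  rw [show (Finset.range 2).filter (Nat.Coprime 2) = {1} by decide, Finset.sum_singleton, h3, Nat.cast_one, mul_one,
    mul_one, hLF, hLF, h1, h2, Complex.conj_ofReal]
  push_cast
  ring

/-- For `σ = ±1` and odd `d₂` the integer `σ d₂` is odd. [folklore] -/
theorem odd_sigma_mul {σ : ℤ} (hσ : σ = 1 ∨ σ = -1) {d₂ : ℕ} (hd₂ : Odd d₂) : Odd (σ * (d₂ : ℤ)) := by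
  rcases hσ with rfl | rfl
  · simpa using hd₂
  · simpa using hd₂

/-- **The `2`-adic factor.** For `σ = ±1`, `d₁` even and `d₂` odd:
`parityLocalTwo = paritySingTerm 1 + paritySingTerm 2 = (1 − 2^{−α})² (2 − 2^{1−α}) = 2 (1 − 2^{−α})³`.
[cite: MontgomeryVaughanActa1975, §6] -/
theorem parityLocalTwo_eq (α : ℝ) {σ : ℤ} (hσ : σ = 1 ∨ σ = -1) {d₁ d₂ : ℕ} (hd₁ : Even d₁) (hd₂ : Odd d₂) :
    parityLocalTwo α σ d₁ d₂ = ((2 * (1 - (2 : ℝ) ^ (-α)) ^ 3 : ℝ) : ℂ) := by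
  have hσd := odd_sigma_mul hσ hd₂
  have h0 : ∀ j ∉ ({0, 1} : Finset ℕ), paritySingTerm α σ d₁ d₂ (2 ^ j) = 0 := fun j hj => by
    simp only [Finset.mem_insert, Finset.mem_singleton, not_or] at hj
    exact paritySingTerm_two_pow_eq_zero α hσd d₁ (by omega)
  change ∑' j : ℕ, paritySingTerm α σ d₁ d₂ (2 ^ j) = _
  rw [tsum_eq_sum h0, Finset.sum_pair zero_ne_one, pow_zero, pow_one, paritySingTerm_one,
    paritySingTerm_two α hσd hd₁]
  push_cast
  ring

/-- `parityLocalTwo` is a positive real number `≥ 2(1 − 2^{−α})³ > 0` for `α > 0`. [folklore] -/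
theorem two_mul_one_sub_two_rpow_pos {α : ℝ} (hα : 0 < α) : 0 < 2 * (1 - (2 : ℝ) ^ (-α)) ^ 3 := by
  have : (2 : ℝ) ^ (-α) < 1 := Real.rpow_lt_one_of_one_lt_of_neg (by norm_num) (by linarith)
  positivity

/-! ### Independence of the power of `2` in `d₁` -/

/-- For odd `k` the unit term only sees `d₁` through its odd part: `parityUnitTerm (d₁ u) = parityUnitTerm d₁` for
`(u, k) = 1`. [folklore] -/
theorem parityUnitTerm_mul_left_of_coprime (α : ℝ) {σ : ℤ} (hσ : σ = 1 ∨ σ = -1) (d₁ d₂ : ℕ) {k u : ℕ}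
    (hu : k.Coprime u) : parityUnitTerm α σ (d₁ * u) d₂ k = parityUnitTerm α σ d₁ d₂ k := by
  rcases eq_or_ne k 0 with rfl | hk
  · simp [parityUnitTerm]
  rw [parityUnitTerm_eq α hσ _ _ hk, parityUnitTerm_eq α hσ _ _ hk, Nat.cast_mul,
    classLocalFactor_one_mul_unit α 0 (u := u) (by simpa using hu)]

/-- **Independence of the power of `2`.** For `σ = ±1`, `d₂` odd, `N ≥ 1` and every `k`:
`paritySingTerm (2^N t) d₂ k = paritySingTerm (2t) d₂ k` (write `k = 2^i k'`: the `2^i`-part depends on `d₁` only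
through its parity, the odd part only through the odd part of `d₁`). [folklore] -/
theorem paritySingTerm_two_pow_mul (α : ℝ) {σ : ℤ} (hσ : σ = 1 ∨ σ = -1) {d₂ : ℕ} (hd₂ : Odd d₂) (t : ℕ) {N : ℕ}
    (hN : 1 ≤ N) (k : ℕ) : paritySingTerm α σ (2 ^ N * t) d₂ k = paritySingTerm α σ (2 * t) d₂ k := by
  rcases eq_or_ne k 0 with rfl | hk
  · simp [paritySingTerm]
  have hσd := odd_sigma_mul hσ hd₂
  obtain ⟨i, k', hk', rfl⟩ := Nat.exists_eq_two_pow_mul_odd hk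
  have h2k' : Nat.Coprime 2 k' := Nat.prime_two.coprime_iff_not_dvd.mpr hk'.not_two_dvd_nat
  have hcop : (2 ^ i).Coprime k' := Nat.Coprime.pow_left i h2k'
  rw [paritySingTerm_mul_of_coprime α σ _ _ hcop hk', paritySingTerm_mul_of_coprime α σ _ _ hcop hk',
    mul_comm (2 ^ N) t, mul_comm 2 t, parityUnitTerm_mul_left_of_coprime α hσ t d₂ (Nat.Coprime.pow_right N h2k'.symm),
    parityUnitTerm_mul_left_of_coprime α hσ t d₂ h2k'.symm]
  congr 1
  rcases i with _ | _ | i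
  · rw [pow_zero, paritySingTerm_one, paritySingTerm_one]
  · have e1 : Even (t * 2 ^ N) := even_iff_two_dvd.mpr (Dvd.dvd.mul_left (dvd_pow_self 2 (by omega)) t)
    have e2 : Even (t * 2) := even_two.mul_left t
    rw [zero_add, pow_one, paritySingTerm_two α hσd e1, paritySingTerm_two α hσd e2]
  · rw [paritySingTerm_two_pow_eq_zero α hσd _ (by omega), paritySingTerm_two_pow_eq_zero α hσd _ (by omega)]

/-- Hence the singular series does not depend on `N ≥ 1`: `𝔖(α, σ, 2^N t, d₂) = 𝔖(α, σ, 2t, d₂)`. [folklore] -/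
theorem paritySingSeries_two_pow_mul (α : ℝ) {σ : ℤ} (hσ : σ = 1 ∨ σ = -1) {d₂ : ℕ} (hd₂ : Odd d₂) (t : ℕ)
    {N : ℕ} (hN : 1 ≤ N) : paritySingSeries α σ (2 ^ N * t) d₂ = paritySingSeries α σ (2 * t) d₂ :=
  tsum_congr fun k => paritySingTerm_two_pow_mul α hσ hd₂ t hN k

/-! ### The modulus-one local factor as a real number; prime powers -/

/-- Real (Kluyver) form of the modulus-one local factor:
`Λ_α(k; h) = Σ_{g ∣ k} c_{k/g}(h) g^{−α} ∏_{p ∣ k/g}(1 − p^{−α})/φ(k/g)`, `c_q(h) = Σ_{d ∣ (q,h)} d μ(q/d)`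
(`ramanujanDivisorSum`). [cite: Harper2016, §2.2] -/
def unitLocalFactor (α : ℝ) (k : ℕ) (h : ℤ) : ℝ :=
  ∑ g ∈ k.divisors, (ramanujanDivisorSum h.natAbs (k / g) : ℝ) *
    (((g : ℕ) : ℝ) ^ (-α) * (∏ p ∈ (k / g).primeFactors, (1 - (p : ℝ) ^ (-α))) / ((k / g).totient : ℝ))

/-- `classLocalFactor α 1 r k h = Λ_α(k; h)` (a real number). [cite: Harper2016, §2.2] -/
theorem classLocalFactor_one_eq_ofReal (α : ℝ) (r k : ℕ) (h : ℤ) :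
    classLocalFactor α 1 r k h = (unitLocalFactor α k h : ℂ) := by
  rcases eq_or_ne k 0 with rfl | hk
  · simp [classLocalFactor, unitLocalFactor]
  rw [classLocalFactor_of_coprime α hk one_ne_zero (Nat.coprime_one_right k) (r := r) (Nat.coprime_one_right r),
    unitLocalFactor, Nat.primeFactors_one, Finset.prod_empty, Nat.totient_one, Nat.cast_one, div_one,
    Complex.ofReal_one, one_mul, Complex.ofReal_sum]
  refine Finset.sum_congr rfl fun g _ => ?_
  rw [ramanujanSum_eq_ramanujanDivisorSum, Complex.ofReal_mul, Complex.ofReal_intCast]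

/-- `Λ_α(1; h) = 1`. [folklore] -/
theorem unitLocalFactor_one (α : ℝ) (h : ℤ) : unitLocalFactor α 1 h = 1 := by
  simp [unitLocalFactor, (isMultiplicative_ramanujanDivisorSum h.natAbs).map_one]

/-- Kluyver at prime powers: `c_{p^{e+1}}(h) = p^{e+1}[p^{e+1} ∣ h] − p^e [p^e ∣ h]`.
[cite: MontgomeryVaughan2007, Thm 4.1 eq. (4.7)] -/
theorem ramanujanDivisorSum_prime_pow_succ (n : ℕ) {p : ℕ} (hp : p.Prime) (e : ℕ) :
    ramanujanDivisorSum n (p ^ (e + 1)) =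
      (if p ^ (e + 1) ∣ n then ((p ^ (e + 1) : ℕ) : ℤ) else 0) - (if p ^ e ∣ n then ((p ^ e : ℕ) : ℤ) else 0) := by
  rw [ramanujanDivisorSum_apply,
    Nat.sum_divisorsAntidiagonal (fun x y => (μ x : ℤ) * (if y ∣ n then (y : ℤ) else 0)),
    Nat.divisors_prime_pow hp, Finset.sum_map]
  simp only [Function.Embedding.coeFn_mk]
  have hd1 : p ^ (e + 1) / p ^ (0 + 1) = p ^ e := by
    rw [zero_add, pow_one, pow_succ, Nat.mul_div_cancel _ hp.pos]
  rw [Finset.sum_range_succ', Finset.sum_range_succ', hd1, Finset.sum_eq_zero, zero_add, pow_zero, Nat.div_one,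
    ArithmeticFunction.moebius_apply_one, zero_add, pow_one, ArithmeticFunction.moebius_apply_prime hp]
  · ring
  · intro i _
    rw [ArithmeticFunction.moebius_apply_prime_pow hp (Nat.succ_ne_zero _), if_neg (by omega), zero_mul]

/-- **Recurrence in the exponent**:
`Λ_α(p^{j+1}; h) = p^{−α} Λ_α(p^j; h) + c_{p^{j+1}}(h) (1 − p^{−α})/φ(p^{j+1})` (shift `g = p·g'` in the divisor sum;
the divisor `g = 1` is the extra term). [folklore] -/
theorem unitLocalFactor_prime_pow_succ (α : ℝ) {p : ℕ} (hp : p.Prime) (j : ℕ) (h : ℤ) :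
    unitLocalFactor α (p ^ (j + 1)) h = (p : ℝ) ^ (-α) * unitLocalFactor α (p ^ j) h +
      (ramanujanDivisorSum h.natAbs (p ^ (j + 1)) : ℝ) * (1 - (p : ℝ) ^ (-α)) / ((p ^ (j + 1)).totient : ℝ) := by
  unfold unitLocalFactor
  rw [Nat.divisors_prime_pow hp (j + 1), Nat.divisors_prime_pow hp j, Finset.sum_map, Finset.sum_map]
  simp only [Function.Embedding.coeFn_mk]
  rw [Finset.sum_range_succ', Finset.mul_sum]
  congr 1
  · refine Finset.sum_congr rfl fun i hi => ?_
    have hi' : i < j + 1 := Finset.mem_range.mp hi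
    rw [Nat.pow_div (by omega) hp.pos, Nat.pow_div (by omega) hp.pos, show j + 1 - (i + 1) = j - i by omega]
    have e1 : (((p ^ (i + 1) : ℕ)) : ℝ) ^ (-α) = (p : ℝ) ^ (-α) * (((p ^ i : ℕ)) : ℝ) ^ (-α) := by
      push_cast
      rw [pow_succ, Real.mul_rpow (by positivity) (by positivity), mul_comm]
    rw [e1]
    ring
  · rw [pow_zero, Nat.div_one, Nat.cast_one, Real.one_rpow, one_mul,
      Nat.primeFactors_prime_pow (Nat.succ_ne_zero j) hp, Finset.prod_singleton]
    ring

/-- **`Λ_α(p^j; h) = 1` if `p^j ∣ h`.** [folklore] -/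
theorem unitLocalFactor_prime_pow_of_dvd (α : ℝ) {p : ℕ} (hp : p.Prime) {j : ℕ} {h : ℤ}
    (hdvd : p ^ j ∣ h.natAbs) : unitLocalFactor α (p ^ j) h = 1 := by
  induction j with
  | zero => rw [pow_zero, unitLocalFactor_one]
  | succ j ih =>
    have hj : p ^ j ∣ h.natAbs := (pow_dvd_pow p (Nat.le_succ j)).trans hdvd
    rw [unitLocalFactor_prime_pow_succ α hp, ih hj, ramanujanDivisorSum_prime_pow_succ _ hp, if_pos hdvd, if_pos hj,
      Nat.totient_prime_pow_succ hp]
    have hp1 : (1 : ℝ) < p := by exact_mod_cast hp.one_lt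
    have hpj : (0 : ℝ) < (p : ℝ) ^ j := by positivity
    have hp1' : (p : ℝ) - 1 ≠ 0 := by linarith
    have hc : ((p - 1 : ℕ) : ℝ) = (p : ℝ) - 1 := by rw [Nat.cast_sub hp.one_le, Nat.cast_one]
    push_cast
    rw [hc]
    field_simp
    ring

/-- **`Λ_α(p^{v+1+i}; h) = G_α(p^{i+1})` if `p^v ∥ h`** (`p^v ∣ h`, `p^{v+1} ∤ h`): the step `v → v+1` uses
`c_{p^{v+1}}(h) = −p^v`, the later steps `c = 0`. [folklore] -/
theorem unitLocalFactor_prime_pow_of_not_dvd (α : ℝ) {p : ℕ} (hp : p.Prime) {v : ℕ} {h : ℤ}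
    (hv : p ^ v ∣ h.natAbs) (hv' : ¬ p ^ (v + 1) ∣ h.natAbs) (i : ℕ) :
    unitLocalFactor α (p ^ (v + 1 + i)) h = localG α (p ^ (i + 1)) := by
  have hp1 : (1 : ℝ) < p := by exact_mod_cast hp.one_lt
  have hp0 : (0 : ℝ) < p := by linarith
  induction i with
  | zero =>
    rw [add_zero, unitLocalFactor_prime_pow_succ α hp, unitLocalFactor_prime_pow_of_dvd α hp hv,
      ramanujanDivisorSum_prime_pow_succ _ hp, if_neg hv', if_pos hv, Nat.totient_prime_pow_succ hp, zero_add, pow_one,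
      localG_eq_prod α hp.ne_zero, hp.primeFactors, Finset.prod_singleton]
    have hpv : (0 : ℝ) < (p : ℝ) ^ v := by positivity
    have hp1' : (p : ℝ) - 1 ≠ 0 := by linarith
    have h2 : (p : ℝ) ^ (-α) * (p : ℝ) ^ α = 1 := by
      rw [← Real.rpow_add hp0, neg_add_cancel, Real.rpow_zero]
    have hc : ((p - 1 : ℕ) : ℝ) = (p : ℝ) - 1 := by rw [Nat.cast_sub hp.one_le, Nat.cast_one]
    push_cast
    rw [hc]
    field_simp
    linear_combination ((p : ℝ) ^ v) * h2
  | succ i ih =>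
    have e : v + 1 + (i + 1) = (v + 1 + i) + 1 := by ring
    have hn1 : ¬ p ^ (v + 1 + i) ∣ h.natAbs := fun hd => hv' ((pow_dvd_pow p (by omega)).trans hd)
    have hn2 : ¬ p ^ (v + 1 + i + 1) ∣ h.natAbs := fun hd => hv' ((pow_dvd_pow p (by omega)).trans hd)
    rw [e, unitLocalFactor_prime_pow_succ α hp, ih, ramanujanDivisorSum_prime_pow_succ _ hp, if_neg hn1, if_neg hn2,
      sub_zero, Int.cast_zero, zero_mul, zero_div, add_zero, localG_eq_prod α (pow_ne_zero _ hp.ne_zero),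
      localG_eq_prod α (pow_ne_zero _ hp.ne_zero), Nat.primeFactors_prime_pow (Nat.succ_ne_zero _) hp,
      Nat.primeFactors_prime_pow (Nat.succ_ne_zero _) hp]
    push_cast
    rw [pow_succ (p : ℝ) (i + 1), Real.mul_rpow (by positivity) hp0.le]
    ring

/-- The valuation split: if `p^j ∤ n` then `j = v + 1 + i` with `p^v ∥ n`. [folklore] -/
theorem exists_eq_add_of_not_pow_dvd {p n j : ℕ} (hp : p.Prime) (h : ¬ p ^ j ∣ n) :
    ∃ v i, j = v + 1 + i ∧ p ^ v ∣ n ∧ ¬ p ^ (v + 1) ∣ n := by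
  have hn : n ≠ 0 := by rintro rfl; exact h (dvd_zero _)
  refine ⟨n.factorization p, j - n.factorization p - 1, ?_, Nat.ordProj_dvd n p,
    Nat.pow_succ_factorization_not_dvd hn hp⟩
  have : ¬ j ≤ n.factorization p := fun hle => h ((pow_dvd_pow p hle).trans (Nat.ordProj_dvd n p))
  omega

/-- `G_α(q) ≤ 1` for `0 ≤ α ≤ 1`, `q ≥ 1`. [folklore] -/
theorem localG_le_one {α : ℝ} (hα0 : 0 ≤ α) (hα1 : α ≤ 1) {q : ℕ} (hq : q ≠ 0) : localG α q ≤ 1 := by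
  rw [localG_eq_prod α hq]
  have h1 : (q : ℝ) ^ (-α) ≤ 1 :=
    Real.rpow_le_one_of_one_le_of_nonpos (by exact_mod_cast Nat.one_le_iff_ne_zero.mpr hq) (by linarith)
  have hfac : ∀ p ∈ q.primeFactors, 0 ≤ ((p : ℝ) - (p : ℝ) ^ α) / ((p : ℝ) - 1) ∧
      ((p : ℝ) - (p : ℝ) ^ α) / ((p : ℝ) - 1) ≤ 1 := by
    intro p hp
    have hp2 : (2 : ℝ) ≤ p := by exact_mod_cast (Nat.prime_of_mem_primeFactors hp).two_le
    have h1p : 1 ≤ (p : ℝ) ^ α := Real.one_le_rpow (by linarith) hα0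
    refine ⟨(local_prime_factor_bounds (Nat.prime_of_mem_primeFactors hp).two_le hα1).1, ?_⟩
    rw [div_le_one (by linarith)]
    linarith
  calc (q : ℝ) ^ (-α) * ∏ p ∈ q.primeFactors, ((p : ℝ) - (p : ℝ) ^ α) / ((p : ℝ) - 1) ≤ 1 * 1 :=
        mul_le_mul h1 (Finset.prod_le_one (fun p hp => (hfac p hp).1) fun p hp => (hfac p hp).2)
          (Finset.prod_nonneg fun p hp => (hfac p hp).1) zero_le_one
    _ = 1 := one_mul 1

/-- **`0 ≤ Λ_α(p^j; h) ≤ 1`** for `0 ≤ α ≤ 1`. [folklore] -/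
theorem unitLocalFactor_prime_pow_mem_Icc {α : ℝ} (hα0 : 0 ≤ α) (hα1 : α ≤ 1) {p : ℕ} (hp : p.Prime) (j : ℕ)
    (h : ℤ) : unitLocalFactor α (p ^ j) h ∈ Set.Icc (0 : ℝ) 1 := by
  by_cases hdvd : p ^ j ∣ h.natAbs
  · rw [unitLocalFactor_prime_pow_of_dvd α hp hdvd]; exact ⟨zero_le_one, le_rfl⟩
  · obtain ⟨v, i, rfl, hv, hv'⟩ := exists_eq_add_of_not_pow_dvd hp hdvd
    rw [unitLocalFactor_prime_pow_of_not_dvd α hp hv hv' i]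
    exact ⟨(localG_bounds hα1 (pow_ne_zero _ hp.ne_zero)).1, localG_le_one hα0 hα1 (pow_ne_zero _ hp.ne_zero)⟩

end SmoothArcs

end Literature.NumberTheory.Sieve

end
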